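import Literature.NumberTheory.Automorphic.Liu2021.LemD1Item4NonsplitLineClass
import Literature.NumberTheory.GelbartRogawski1991.LocalLineModelTransport
import HarnessLib

/-!
# [Liu2021, Lem. D.1 (4)] at `n = 2`, non-split place — (W) the CLASS WITNESS of ROAD-L4if v4 link (ii): `a′ ~ b` for every line `b` in the class of
# `(−t₀t₁)·a` up to a square, as the `hx` units equation of the `e′_a` line transport — THEOREMS ONLY

Topic `NumberTheory/Automorphic/Liu2021`; namespace `Literature.NumberTheory.Automorphic.Liu2021.Def411WeilCarriers` (home of ★ `locF`, `epsLine`, ★ (C5)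
`sameClass_epsLine_neg_det_mul`).  KERNEL ONLY: theorems; no definition, no named fact, no `sorry`.  Cell `hodgecm-mathlib` (D-0151), programme P5
(crux HLiu418 = stmt-HodgeConjecture-24832); sequel of ★ `LemD1Item4NonsplitLineClass.lean` ((C5), A-p18 (g23)).


The assembler of the last local letter L4-if (A-p18 (g24), `F0/P5/A-p18/g24/ROAD-L4if-v4.A-p18g24.md` §2 (ii)) moves the θ-package local factor from the
member's line `a′` to the line `−a₀`, `a₀ := (a·t₀t₁)⁻¹`, by the class move ★ `F0P5LemD14IfClassMove.areIsomorphicRep_theta_cmPackage_classMove`, whose ONE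
hypothesis is the units equation `hx : a₂⁻¹δ ⊗ 1 = x·xᶜ·(a₁⁻¹δ ⊗ 1)` in `E_v = E ⊗ F_v`.  This file supplies that witness from ★ (C5): `(−t₀t₁)·a` and
`−a₀ = (−t₀t₁)·a·a₀²` differ by a SQUARE of `F^×`, squares are local norms (★ `mul_self_mem_quadraticNormSubgroup`), so `a′ ~ b` for every
`b = (−t₀t₁)·a·u²` (`sameClass_epsLine_neg_det_mul_mul_sq`), and the tree's dictionary ★ `sameClass_epsLine_iff_sameClass_eps_lineDelta` turns the class
statement into the units equation at the transported lines `δ/a′`, `δ/b` (`exists_lineDelta_witness_of_lemD1_4_hypotheses`).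
Nothing of the cited sources is asserted; HC_CM is proved only modulo the printed citations until rung 0 closes.

## References
* [Liu2021] Y. Liu, App. D §D.1 Step 1 (l. 5217), Lemma D.1 (4) (l. 5235); Def. 4.12 (l. 2105).
* [Omeara1963] O. T. O'Meara, Introduction to Quadratic Forms (1963), §63B Cor. 63:13a.
-/

set_option autoImplicit false

noncomputable section

open scoped Matrix NumberField
open NumberField IsDedekindDomain
open Literature.NumberTheory Literature.NumberTheory.Automorphic Literature.NumberTheory.Automorphic.UnitaryGroup
open Literature.RepresentationTheory
open Literature.NumberTheory.QuadraticForms (quadraticNormSubgroup mul_self_mem_quadraticNormSubgroup)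
open Literature.NumberTheory.GelbartRogawski1991.UnitaryDualPair.LocalSplitting (sameClass_epsLine_iff_sameClass_eps_lineDelta)

namespace Literature.NumberTheory.Automorphic.Liu2021.Def411WeilCarriers

section Witness

variable (F E : Type) [Field F] [NumberField F] [Field E] [NumberField E] [Algebra F E] (c : E ≃ₐ[F] E)
  [Algebra.IsQuadraticExtension F E] {δ : E} (hcδ : c δ = -δ) (hδ : δ ≠ 0) {d : F} (hd : δ * δ = algebraMap F E d)
  (v : HeightOneSpectrum (𝓞 F)) (t : Fin 2 → F) (ht : ∀ i, t i ≠ 0)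
  {J : Matrix (Fin 2) (Fin 2) E} (hJ : J = (Matrix.diagonal t).map (algebraMap F E)) (hJh : (J.map c)ᵀ = J) (hJdet : J.det ≠ 0)

/-- **squares are local norms**: the `v`-component of [Liu2021, Def. 4.12]'s collection `locF` kills squares, `locF (b·u²) v = locF b v`
(`u² = u·u ∈ Nm E_v^×`, ★ `mul_self_mem_quadraticNormSubgroup`). [cite: Liu2021, Def. 4.12 (l. 2105)] [cite: Omeara1963, §63B Cor. 63:13a] -/
theorem locF_apply_mul_sq (b u : Fˣ) : locF F d (b * u ^ 2) v = locF F d b v := by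
  have h : locF F d (u ^ 2) = 1 := by
    funext w
    rw [map_pow, Pi.pow_apply, Pi.one_apply, locF_apply, ← QuotientGroup.mk_pow, pow_two, QuotientGroup.eq_one_iff]
    exact mul_self_mem_quadraticNormSubgroup _ _
  rw [map_mul, h]
  exact congrFun (mul_one (locF F d b)) v

include hcδ hδ hd hJ hJh hJdet ht in
/-- **[Liu2021, Lem. D.1 (4)], the line bookkeeping at a place, `n = 2`, up to squares.**  Under the letter's two class hypotheses for the Step-1
representatives of the lines `a, a′` (`ε′ ~ ε` if `V_v` is isotropic, `ε′ ≁ ε` if anisotropic), **`ε′ ~` the representative of EVERY line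
`b = (−t₀t₁)·a·u²`** (★ (C5) `sameClass_epsLine_neg_det_mul` and `locF_apply_mul_sq` through ★ `sameClass_epsLine_iff_locF_apply_eq`) — e.g. `b = −a₀`,
`a₀ = (a·t₀t₁)⁻¹`, `u = a₀`. [cite: Liu2021, App. D Lemma D.1 (4) (l. 5235); §D.1 Step 1 (l. 5217)] [cite: Omeara1963, §63B Cor. 63:13a] -/
theorem sameClass_epsLine_neg_det_mul_mul_sq (a a' b u : Fˣ) (hb : b = -(Units.mk0 (t 0 * t 1) (mul_ne_zero (ht 0) (ht 1))) * a * u ^ 2)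
    (hiso : LemD1.IsIsotropic (LemD1OfPlace.standingData E v c 2 J hcδ hδ le_rfl hJh hJdet) →
      LemD1.SameClass (S := LemD1OfPlace.standingData E v c 2 J hcδ hδ le_rfl hJh hJdet)
        ⟨epsLine E hδ a v, epsLine_mem_skew E c 2 J hcδ hδ le_rfl hJh hJdet a v⟩
        ⟨epsLine E hδ a' v, epsLine_mem_skew E c 2 J hcδ hδ le_rfl hJh hJdet a' v⟩)
    (han : ¬ LemD1.IsIsotropic (LemD1OfPlace.standingData E v c 2 J hcδ hδ le_rfl hJh hJdet) →
      ¬ LemD1.SameClass (S := LemD1OfPlace.standingData E v c 2 J hcδ hδ le_rfl hJh hJdet)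
        ⟨epsLine E hδ a v, epsLine_mem_skew E c 2 J hcδ hδ le_rfl hJh hJdet a v⟩
        ⟨epsLine E hδ a' v, epsLine_mem_skew E c 2 J hcδ hδ le_rfl hJh hJdet a' v⟩) :
    LemD1.SameClass (S := LemD1OfPlace.standingData E v c 2 J hcδ hδ le_rfl hJh hJdet)
      ⟨epsLine E hδ b v, epsLine_mem_skew E c 2 J hcδ hδ le_rfl hJh hJdet b v⟩
      ⟨epsLine E hδ a' v, epsLine_mem_skew E c 2 J hcδ hδ le_rfl hJh hJdet a' v⟩ := by
  apply sameClass_epsLine_of_locF_apply_eq F E c 2 J hcδ hδ hd le_rfl hJh hJdet v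
  -- `locF b v = locF ((−t₀t₁)·a) v = locF a′ v`
  rw [hb, locF_apply_mul_sq]
  exact locF_apply_eq_of_sameClass_epsLine F E c 2 J hcδ hδ hd le_rfl hJh hJdet v _ a'
    (sameClass_epsLine_neg_det_mul F E c hcδ hδ hd v t ht hJ hJh hJdet a a' hiso han)

include hcδ hd hJ hJh hJdet ht in
/-- **(W) THE CLASS WITNESS OF ROAD-L4if v4 LINK (ii) AS A UNITS EQUATION.**  Under the letter's two class hypotheses for the lines `a, a′` at the
place `v` (`n = 2`), for every line `b = (−t₀t₁)·a·u²` there is a unit `x` of `E_v` with **`(a′⁻¹δ) ⊗ 1 = x · xᶜ · ((b⁻¹δ) ⊗ 1)`** — literally the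
hypothesis `hx` of ★ `F0P5LemD14IfClassMove.areIsomorphicRep_theta_cmPackage_classMove` at `(a₁, a₂) := (b, a′)` (so `Θ(θ, a′) ≅ Θ(θ, b)`), and of ★
`lineTransportSplitting` at the transported lines `δ/b`, `δ/a′` (`sameClass_epsLine_neg_det_mul_mul_sq` read through ★
`sameClass_epsLine_iff_sameClass_eps_lineDelta`: the two pairs of representatives differ by the norms `b², a′²`).
[cite: Liu2021, App. D Lemma D.1 (4) (l. 5235); §D.1 Step 1 (l. 5217)] [cite: Omeara1963, §63B Cor. 63:13a] -/
theorem exists_lineDelta_witness_of_lemD1_4_hypotheses (a a' b u : Fˣ)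
    (hb : b = -(Units.mk0 (t 0 * t 1) (mul_ne_zero (ht 0) (ht 1))) * a * u ^ 2)
    (hiso : LemD1.IsIsotropic (LemD1OfPlace.standingData E v c 2 J hcδ hδ le_rfl hJh hJdet) →
      LemD1.SameClass (S := LemD1OfPlace.standingData E v c 2 J hcδ hδ le_rfl hJh hJdet)
        ⟨epsLine E hδ a v, epsLine_mem_skew E c 2 J hcδ hδ le_rfl hJh hJdet a v⟩
        ⟨epsLine E hδ a' v, epsLine_mem_skew E c 2 J hcδ hδ le_rfl hJh hJdet a' v⟩)
    (han : ¬ LemD1.IsIsotropic (LemD1OfPlace.standingData E v c 2 J hcδ hδ le_rfl hJh hJdet) →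
      ¬ LemD1.SameClass (S := LemD1OfPlace.standingData E v c 2 J hcδ hδ le_rfl hJh hJdet)
        ⟨epsLine E hδ a v, epsLine_mem_skew E c 2 J hcδ hδ le_rfl hJh hJdet a v⟩
        ⟨epsLine E hδ a' v, epsLine_mem_skew E c 2 J hcδ hδ le_rfl hJh hJdet a' v⟩) :
    ∃ x : (LocalRing E v)ˣ, algebraMap E (LocalRing E v) (algebraMap F E (↑a'⁻¹ : F) * δ) =
      (x : LocalRing E v) * conjLocal E c v x * algebraMap E (LocalRing E v) (algebraMap F E (↑b⁻¹ : F) * δ) := by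
  obtain ⟨x, hx⟩ := (sameClass_epsLine_iff_sameClass_eps_lineDelta F E c v b a' (hδ := hδ)).1
    (sameClass_epsLine_neg_det_mul_mul_sq F E c hcδ hδ hd v t ht hJ hJh hJdet a a' b u hb hiso han)
  refine ⟨x, ?_⟩
  rw [Units.ext_iff, Units.val_mul, Units.val_mul, Units.coe_map] at hx
  exact hx

end Witness

end Literature.NumberTheory.Automorphic.Liu2021.Def411WeilCarriers

end
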